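import Summits.Ventures.DiscreteObjects.Hadamard.ConferenceGraph333CycleParity
import Summits.Ventures.DiscreteObjects.Hadamard.FixedStructure

/-!
# The fixed-point subgraph of an automorphism of srg(333,166,82,83): congruences mod p; ORDER 23 EXCLUDED,
# order 11 ⇒ f = 25, order 7 ⇒ f ∈ {25, 39}, order 13 ⇒ the fixed points induce an srg(21,10,4,5) (kernel)

Framing: lottery ticket; floor = certified bounds/negative ranges.  Cell pub-namedobj (venture DiscreteObjects),
target (H) = `H(668)`, hadamard gen 30.  Continues the automorphism census of `srg(333,166,82,83)` ⇔ symmetric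
`C(334)` (⇒ `H(668)`) of gens 27–29 with a tool those files do not use — the FIXED-POINT SUBGRAPH.  If `σ`
(`σ^p = 1`, `p` prime) preserves adjacency and fixes `x`, then `N(x)` is `σ`-invariant, hence the union of `N(x) ∩ F`
(`F = Fix σ`) and whole `p`-orbits; likewise `N(x) ∩ N(y)` for fixed `x, y`.  So on `F`:
`deg_F(x) ≡ 166`, `λ_F(x,y) ≡ 82`, `μ_F(x,y) ≡ 83 (mod p)` — the induced subgraph is an "srg modulo `p`".
* `aut_fixed_row_congr`, `aut_fixed_pair_congr` — `Σ_{y ∈ F} A_xy + p·a = Σ_y A_xy (= 166)` and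
  `Σ_{z ∈ F} A_xz A_zy + p·b = Σ_z A_xz A_zy (= 83(1+[x=y]) − A_xy)` for fixed `x, y` (`FixedStructure.dvd_sum_moved`).
* `sum_sum_adj_even` (handshake: `Σ_{x,y ∈ F} A_xy` is even), `sum_adj_bounds`, `sum_adj_mul_bounds` (trivial bounds).
* **`aut_fixed_card_ne_three`** (`p ∈ {3, 5, 11}`, `f = 3` impossible: `F` would be `1`-regular on `3` vertices),
  **`aut_fixed_card_ne_eleven`** (`p ∈ {7, 23}`, `f = 11` impossible: `5`-regular on `11` vertices).
* **`no_aut_order_23`** — NO AUTOMORPHISM OF ORDER 23 (gen 29's window was `f = 11`).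
* **`aut_order11_fixed`** (`f = 25` exactly), **`aut_order7_fixed`** (`f ∈ {25, 39}`),
  **`aut_order13_fixed_srg`** — for `σ` of order `13` (`f = 21`, gen 29) the fixed points induce an
  `srg(21, 10, 4, 5)`: `Σ_{y∈F} A_xy = 10` and `Σ_{z∈F} A_xz A_zy = 5(1 + [x=y]) − A_xy` on `F` (a conference graph on
  `21` vertices — which does not exist, `ConferenceThreeAdicObstruction.no_conferenceGraph_21`; the order-13 exclusion
  is drawn in `ConferenceGraph333Order13`).
* **`aut_prime_windows_fs`**, **`aut_prime_spectrum_fs`** — prime-order spectrum now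
  `⊆ {2, 3, 5, 7, 11, 13, 37, 41, 83}` with windows `3: f ≡ 3 (6), 9 ≤ f ≤ 81 · 5: f ≡ 3 (10), 13 ≤ f ≤ 53 ·
  7: {25, 39} · 11: {25} · 13: {21} · 37: {0} · 41: {5} · 83: {1}`.
METHOD IN PRINT: orbit matrices / fixed structures of strongly regular graphs under a prime-order automorphism
(Behbahani–Lam, Discrete Math. 311 (2011); Crnković–Maksimović et al.); the instance and the kernel proofs are ours
(PROVISIONAL).  WORDS: structure of a HYPOTHETICAL object; no srg(333,166,82,83) / C(334) / H(668) is constructed or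
excluded.  No `sorry`, no new definitions.
-/

namespace Summit.Ventures.DiscreteObjects.Hadamard

open Finset

section fixedSubgraph
variable {V : Type*} [Fintype V] [DecidableEq V]

/-- **Row congruence at a fixed vertex.**  For `σ^p = 1` (`p` prime) preserving `A` and `σ x = x`:
`Σ_{y ∈ Fix σ} A_xy + p·a = Σ_y A_xy` for some integer `a` (the moved part of `N(x)` is a union of `p`-orbits). -/
theorem aut_fixed_row_congr (A : Matrix V V ℤ) {p : ℕ} (hp : p.Prime) (σ : Equiv.Perm V) (hσ : σ ^ p = 1)
    (hA : ∀ x y, A (σ x) (σ y) = A x y) {x : V} (hx : σ x = x) :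
    ∃ a : ℤ, (∑ y ∈ univ.filter (fun y => σ y = y), A x y) + p * a = ∑ y, A x y := by
  obtain ⟨a, ha⟩ := dvd_sum_moved σ hp hσ (fun y => A x y) (fun y₀ _ i => by
    show A x ((σ ^ i) y₀) = A x y₀
    conv_lhs => rw [← perm_pow_apply_of_fixed σ hx i]
    exact adj_pow_invariant A σ hA i x y₀)
  refine ⟨a, ?_⟩
  rw [← Finset.sum_filter_add_sum_filter_not univ (fun y => σ y = y) (fun y => A x y)]
  have h : (∑ y ∈ univ.filter (fun y => ¬ σ y = y), A x y) = (p : ℤ) * a := ha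
  rw [h]

/-- **Pair congruence at two fixed vertices.**  For fixed `x, y`: `Σ_{z ∈ Fix σ} A_xz A_zy + p·b = Σ_z A_xz A_zy`. -/
theorem aut_fixed_pair_congr (A : Matrix V V ℤ) {p : ℕ} (hp : p.Prime) (σ : Equiv.Perm V) (hσ : σ ^ p = 1)
    (hA : ∀ x y, A (σ x) (σ y) = A x y) {x y : V} (hx : σ x = x) (hy : σ y = y) :
    ∃ b : ℤ, (∑ z ∈ univ.filter (fun z => σ z = z), A x z * A z y) + p * b = ∑ z, A x z * A z y := by
  obtain ⟨b, hb⟩ := dvd_sum_moved σ hp hσ (fun z => A x z * A z y) (fun z₀ _ i => by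
    show A x ((σ ^ i) z₀) * A ((σ ^ i) z₀) y = A x z₀ * A z₀ y
    conv_lhs => rw [← perm_pow_apply_of_fixed σ hx i, ← perm_pow_apply_of_fixed σ hy i]
    rw [adj_pow_invariant A σ hA i x z₀, adj_pow_invariant A σ hA i z₀ y])
  refine ⟨b, ?_⟩
  rw [← Finset.sum_filter_add_sum_filter_not univ (fun z => σ z = z) (fun z => A x z * A z y)]
  have h : (∑ z ∈ univ.filter (fun z => ¬ σ z = z), A x z * A z y) = (p : ℤ) * b := hb
  rw [h]

omit [Fintype V] in
/-- **Handshake.**  For a symmetric zero-diagonal `A` and any vertex set `F`, `Σ_{x ∈ F} Σ_{y ∈ F} A_xy` is even. -/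
theorem sum_sum_adj_even (A : Matrix V V ℤ) (hsymm : ∀ x y, A y x = A x y) (hdiag : ∀ x, A x x = 0)
    (F : Finset V) : 2 ∣ ∑ x ∈ F, ∑ y ∈ F, A x y := by
  induction F using Finset.induction_on with
  | empty => simp
  | insert v F hv ih =>
    obtain ⟨e, he⟩ := ih
    refine ⟨(∑ y ∈ F, A v y) + e, ?_⟩
    rw [Finset.sum_insert hv, Finset.sum_insert hv, hdiag]
    have h1 : ∀ x ∈ F, ∑ y ∈ insert v F, A x y = A v x + ∑ y ∈ F, A x y := by
      intro x _; rw [Finset.sum_insert hv, hsymm v x]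
    rw [Finset.sum_congr rfl h1, Finset.sum_add_distrib, he]; ring

omit [Fintype V] in
/-- trivial bounds for a `0/1` zero-diagonal matrix: `0 ≤ Σ_{y ∈ F} A_xy ≤ |F| − 1` for `x ∈ F`. -/
theorem sum_adj_bounds (A : Matrix V V ℤ) (h01 : ∀ x y, A x y = 0 ∨ A x y = 1) (hdiag : ∀ x, A x x = 0)
    (F : Finset V) {x : V} (hx : x ∈ F) :
    0 ≤ ∑ y ∈ F, A x y ∧ (∑ y ∈ F, A x y) + 1 ≤ F.card := by
  have hle : ∀ y, A x y ≤ 1 := fun y => by rcases h01 x y with h | h <;> simp [h]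
  have hge : ∀ y, 0 ≤ A x y := fun y => by rcases h01 x y with h | h <;> simp [h]
  refine ⟨Finset.sum_nonneg fun y _ => hge y, ?_⟩
  rw [← Finset.sum_erase_add _ _ hx, hdiag, add_zero]
  have h1 : ∑ y ∈ F.erase x, A x y ≤ ∑ y ∈ F.erase x, (1 : ℤ) := Finset.sum_le_sum fun y _ => hle y
  rw [Finset.sum_const, nsmul_eq_mul, mul_one, Finset.card_erase_of_mem hx] at h1
  have hpos : 1 ≤ F.card := Finset.card_pos.mpr ⟨x, hx⟩
  push_cast [Nat.cast_sub hpos] at h1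
  linarith

omit [Fintype V] in
/-- trivial bounds for common neighbours inside `F`: `0 ≤ Σ_{z ∈ F} A_xz A_zy ≤ Σ_{z ∈ F} A_xz − A_xy` for `y ∈ F`. -/
theorem sum_adj_mul_bounds (A : Matrix V V ℤ) (h01 : ∀ x y, A x y = 0 ∨ A x y = 1) (hdiag : ∀ x, A x x = 0)
    (F : Finset V) (x : V) {y : V} (hy : y ∈ F) :
    0 ≤ ∑ z ∈ F, A x z * A z y ∧ (∑ z ∈ F, A x z * A z y) + A x y ≤ ∑ z ∈ F, A x z := by
  have hge : ∀ u w, 0 ≤ A u w := fun u w => by rcases h01 u w with h | h <;> simp [h]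
  have hle : ∀ u w, A u w ≤ 1 := fun u w => by rcases h01 u w with h | h <;> simp [h]
  refine ⟨Finset.sum_nonneg fun z _ => mul_nonneg (hge x z) (hge z y), ?_⟩
  rw [← Finset.sum_erase_add _ _ hy, ← Finset.sum_erase_add F (fun z => A x z) hy, hdiag y, mul_zero, add_zero]
  have h1 : ∑ z ∈ F.erase y, A x z * A z y ≤ ∑ z ∈ F.erase y, A x z :=
    Finset.sum_le_sum fun z _ => by nlinarith [hge x z, hle z y]
  linarith

omit [Fintype V] [DecidableEq V] in
/-- common neighbours of `x` with itself inside `F` = its `F`-degree (`A_xz² = A_xz`, symmetry). -/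
theorem sum_adj_mul_self (A : Matrix V V ℤ) (h01 : ∀ x y, A x y = 0 ∨ A x y = 1) (hsymm : ∀ x y, A y x = A x y)
    (F : Finset V) (x : V) : ∑ z ∈ F, A x z * A z x = ∑ z ∈ F, A x z :=
  Finset.sum_congr rfl fun z _ => by rw [hsymm x z]; rcases h01 x z with h | h <;> simp [h]

/-- **`f ≠ 3` for `p ∈ {3, 5, 11}`.**  Each fixed vertex would have `F`-degree `≡ 166 ≡ 1 (mod p)` in `{0,1,2}`, i.e.
exactly `1`: a `1`-regular graph on `3` vertices, contradicting the handshake. -/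
theorem aut_fixed_card_ne_three (A : Matrix V V ℤ)
    (h01 : ∀ x y, A x y = 0 ∨ A x y = 1) (hsymm : ∀ x y, A y x = A x y) (hdiag : ∀ x, A x x = 0)
    (hk : ∀ x, ∑ y, A x y = 166) {p : ℕ} (hp : p.Prime) (hp' : p = 3 ∨ p = 5 ∨ p = 11)
    (σ : Equiv.Perm V) (hσ : σ ^ p = 1) (hA : ∀ x y, A (σ x) (σ y) = A x y)
    (hf : (univ.filter fun x => σ x = x).card = 3) : False := by
  set F := univ.filter fun x => σ x = x with hF
  have hS : ∀ x ∈ F, ∑ y ∈ F, A x y = 1 := by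
    intro x hx
    have hx' : σ x = x := (Finset.mem_filter.mp hx).2
    obtain ⟨a, ha⟩ := aut_fixed_row_congr A hp σ hσ hA hx'
    rw [← hF, hk x] at ha
    obtain ⟨h0, h1⟩ := sum_adj_bounds A h01 hdiag F hx
    rw [hf] at h1
    rcases hp' with rfl | rfl | rfl <;> push_cast at ha h1 <;> omega
  have hsum : ∑ x ∈ F, ∑ y ∈ F, A x y = 3 := by
    rw [Finset.sum_congr rfl hS, Finset.sum_const, hf]; norm_num
  have h2 := sum_sum_adj_even A hsymm hdiag F
  rw [hsum] at h2
  omega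

/-- **`f ≠ 11` for `p ∈ {7, 23}`.**  Each fixed vertex would have `F`-degree `≡ 166 ≡ 5 (mod p)` in `[0, 10]`, i.e.
exactly `5`: a `5`-regular graph on `11` vertices, contradicting the handshake (`55` is odd). -/
theorem aut_fixed_card_ne_eleven (A : Matrix V V ℤ)
    (h01 : ∀ x y, A x y = 0 ∨ A x y = 1) (hsymm : ∀ x y, A y x = A x y) (hdiag : ∀ x, A x x = 0)
    (hk : ∀ x, ∑ y, A x y = 166) {p : ℕ} (hp : p.Prime) (hp' : p = 7 ∨ p = 23)
    (σ : Equiv.Perm V) (hσ : σ ^ p = 1) (hA : ∀ x y, A (σ x) (σ y) = A x y)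
    (hf : (univ.filter fun x => σ x = x).card = 11) : False := by
  set F := univ.filter fun x => σ x = x with hF
  have hS : ∀ x ∈ F, ∑ y ∈ F, A x y = 5 := by
    intro x hx
    have hx' : σ x = x := (Finset.mem_filter.mp hx).2
    obtain ⟨a, ha⟩ := aut_fixed_row_congr A hp σ hσ hA hx'
    rw [← hF, hk x] at ha
    obtain ⟨h0, h1⟩ := sum_adj_bounds A h01 hdiag F hx
    rw [hf] at h1
    rcases hp' with rfl | rfl <;> push_cast at ha h1 <;> omega
  have hsum : ∑ x ∈ F, ∑ y ∈ F, A x y = 55 := by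
    rw [Finset.sum_congr rfl hS, Finset.sum_const, hf]; norm_num
  have h2 := sum_sum_adj_even A hsymm hdiag F
  rw [hsum] at h2
  omega

/-- **NO AUTOMORPHISM OF ORDER 23** of an `srg(333,166,82,83)`: gen 29's window forces `f = 11`, and the fixed
vertices would induce a `5`-regular graph on `11` vertices. -/
theorem no_aut_order_23 (hV : Fintype.card V = 333) (A : Matrix V V ℤ)
    (h01 : ∀ x y, A x y = 0 ∨ A x y = 1) (hsymm : ∀ x y, A y x = A x y) (hdiag : ∀ x, A x x = 0)
    (hk : ∀ x, ∑ y, A x y = 166) (hsrg : ∀ x y, ∑ z, A x z * A z y = 83 * (1 + (if x = y then 1 else 0)) - A x y)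
    (σ : Equiv.Perm V) (hσ : σ ^ 23 = 1) (hσ1 : σ ≠ 1) (hA : ∀ x y, A (σ x) (σ y) = A x y) : False := by
  have hp : Nat.Prime 23 := by norm_num
  obtain ⟨-, -, -, -, -, -, w23, -, -, -⟩ :=
    aut_prime_windows_refined hV A h01 hsymm hdiag hk hsrg hp (by norm_num) σ hσ hσ1 hA
  exact aut_fixed_card_ne_eleven A h01 hsymm hdiag hk hp (Or.inr rfl) σ hσ hA (w23 rfl)

/-- `σ^(23k) = 1 ⇒ σ^k = 1` (no element of order divisible by `23`). -/
theorem no_aut_pow_eq_one_23 (hV : Fintype.card V = 333) (A : Matrix V V ℤ)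
    (h01 : ∀ x y, A x y = 0 ∨ A x y = 1) (hsymm : ∀ x y, A y x = A x y) (hdiag : ∀ x, A x x = 0)
    (hk : ∀ x, ∑ y, A x y = 166) (hsrg : ∀ x y, ∑ z, A x z * A z y = 83 * (1 + (if x = y then 1 else 0)) - A x y)
    (σ : Equiv.Perm V) {k : ℕ} (hσ : σ ^ (23 * k) = 1) (hA : ∀ x y, A (σ x) (σ y) = A x y) : σ ^ k = 1 := by
  by_contra h
  have h23 : (σ ^ k) ^ 23 = 1 := by rw [← pow_mul, mul_comm]; exact hσ
  exact no_aut_order_23 hV A h01 hsymm hdiag hk hsrg (σ ^ k) h23 h (adj_pow_invariant A σ hA k)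

/-- **Order 11 ⇒ exactly `25` fixed points** (gen 29: `f ∈ {3, 25}`; `f = 3` is excluded by the fixed subgraph). -/
theorem aut_order11_fixed (hV : Fintype.card V = 333) (A : Matrix V V ℤ)
    (h01 : ∀ x y, A x y = 0 ∨ A x y = 1) (hsymm : ∀ x y, A y x = A x y) (hdiag : ∀ x, A x x = 0)
    (hk : ∀ x, ∑ y, A x y = 166) (hsrg : ∀ x y, ∑ z, A x z * A z y = 83 * (1 + (if x = y then 1 else 0)) - A x y)
    (σ : Equiv.Perm V) (hσ : σ ^ 11 = 1) (hσ1 : σ ≠ 1) (hA : ∀ x y, A (σ x) (σ y) = A x y) :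
    (univ.filter fun x => σ x = x).card = 25 := by
  have hp : Nat.Prime 11 := by norm_num
  obtain ⟨-, -, -, w11, -, -, -, -, -, -⟩ :=
    aut_prime_windows_refined hV A h01 hsymm hdiag hk hsrg hp (by norm_num) σ hσ hσ1 hA
  rcases w11 rfl with h3 | h25
  · exact (aut_fixed_card_ne_three A h01 hsymm hdiag hk hp (Or.inr (Or.inr rfl)) σ hσ hA h3).elim
  · exact h25

/-- **Order 7 ⇒ `f ∈ {25, 39}`** (gen 28/29: `{11, 25, 39}`; `f = 11` is excluded by the fixed subgraph). -/
theorem aut_order7_fixed (hV : Fintype.card V = 333) (A : Matrix V V ℤ)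
    (h01 : ∀ x y, A x y = 0 ∨ A x y = 1) (hsymm : ∀ x y, A y x = A x y) (hdiag : ∀ x, A x x = 0)
    (hk : ∀ x, ∑ y, A x y = 166) (hsrg : ∀ x y, ∑ z, A x z * A z y = 83 * (1 + (if x = y then 1 else 0)) - A x y)
    (σ : Equiv.Perm V) (hσ : σ ^ 7 = 1) (hσ1 : σ ≠ 1) (hA : ∀ x y, A (σ x) (σ y) = A x y) :
    (univ.filter fun x => σ x = x).card = 25 ∨ (univ.filter fun x => σ x = x).card = 39 := by
  have hp : Nat.Prime 7 := by norm_num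
  obtain ⟨-, -, w7, -, -, -, -, -, -, -⟩ :=
    aut_prime_windows_refined hV A h01 hsymm hdiag hk hsrg hp (by norm_num) σ hσ hσ1 hA
  rcases w7 rfl with h11 | h25 | h39
  · exact (aut_fixed_card_ne_eleven A h01 hsymm hdiag hk hp (Or.inl rfl) σ hσ hA h11).elim
  · exact Or.inl h25
  · exact Or.inr h39

/-- **Order 3 or 5 ⇒ `f ≠ 3`** restated as lower bounds: `p = 3 ⇒ 9 ≤ f`, `p = 5 ⇒ 13 ≤ f`. -/
theorem aut_order3_order5_fixed_lb (hV : Fintype.card V = 333) (A : Matrix V V ℤ)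
    (h01 : ∀ x y, A x y = 0 ∨ A x y = 1) (hsymm : ∀ x y, A y x = A x y) (hdiag : ∀ x, A x x = 0)
    (hk : ∀ x, ∑ y, A x y = 166) (hsrg : ∀ x y, ∑ z, A x z * A z y = 83 * (1 + (if x = y then 1 else 0)) - A x y)
    {p : ℕ} (hp : p.Prime) (σ : Equiv.Perm V) (hσ : σ ^ p = 1) (hσ1 : σ ≠ 1) (hA : ∀ x y, A (σ x) (σ y) = A x y) :
    (p = 3 → 9 ≤ (univ.filter fun x => σ x = x).card) ∧ (p = 5 → 13 ≤ (univ.filter fun x => σ x = x).card) := by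
  have hne3 : p = 3 ∨ p = 5 → (univ.filter fun x => σ x = x).card ≠ 3 := fun hp' h3 =>
    aut_fixed_card_ne_three A h01 hsymm hdiag hk hp (by rcases hp' with h | h; exact Or.inl h; exact Or.inr (Or.inl h))
      σ hσ hA h3
  constructor
  · rintro rfl
    obtain ⟨w3, -⟩ := aut_prime_windows_refined hV A h01 hsymm hdiag hk hsrg hp (by norm_num) σ hσ hσ1 hA
    have h := w3 rfl
    have hne := hne3 (Or.inl rfl)
    omega
  · rintro rfl
    obtain ⟨-, w5, -⟩ := aut_prime_windows_refined hV A h01 hsymm hdiag hk hsrg hp (by norm_num) σ hσ hσ1 hA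
    have h := w5 rfl
    have hne := hne3 (Or.inr rfl)
    omega

/-- **Order 13 ⇒ the `21` fixed points induce an `srg(21, 10, 4, 5)`.**  With `F = Fix σ` (`|F| = 21`, gen 29):
every fixed vertex has exactly `10` neighbours in `F` (`≡ 166 (mod 13)` in `[0, 20]`), and for fixed `x, y`:
`Σ_{z ∈ F} A_xz A_zy = 5(1 + [x = y]) − A_xy` (`≡ 83 − A_xy (mod 13)` in `[0, 10 − A_xy]`).  A conference graph on
`21` vertices — none exists (`ConferenceThreeAdicObstruction.no_conferenceGraph_21`). -/
theorem aut_order13_fixed_srg (hV : Fintype.card V = 333) (A : Matrix V V ℤ)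
    (h01 : ∀ x y, A x y = 0 ∨ A x y = 1) (hsymm : ∀ x y, A y x = A x y) (hdiag : ∀ x, A x x = 0)
    (hk : ∀ x, ∑ y, A x y = 166) (hsrg : ∀ x y, ∑ z, A x z * A z y = 83 * (1 + (if x = y then 1 else 0)) - A x y)
    (σ : Equiv.Perm V) (hσ : σ ^ 13 = 1) (hσ1 : σ ≠ 1) (hA : ∀ x y, A (σ x) (σ y) = A x y) :
    (univ.filter fun x => σ x = x).card = 21 ∧
    (∀ x ∈ univ.filter (fun x => σ x = x), ∑ y ∈ univ.filter (fun x => σ x = x), A x y = 10) ∧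
    (∀ x ∈ univ.filter (fun x => σ x = x), ∀ y ∈ univ.filter (fun x => σ x = x),
      ∑ z ∈ univ.filter (fun x => σ x = x), A x z * A z y = 5 * (1 + (if x = y then 1 else 0)) - A x y) := by
  have hp : Nat.Prime 13 := by norm_num
  have hf := aut_order13_fixed hV A h01 hsymm hdiag hk hsrg σ hσ hσ1 hA
  set F := univ.filter fun x => σ x = x with hF
  have hS : ∀ x ∈ F, ∑ y ∈ F, A x y = 10 := by
    intro x hx
    have hx' : σ x = x := (Finset.mem_filter.mp hx).2
    obtain ⟨a, ha⟩ := aut_fixed_row_congr A hp σ hσ hA hx'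
    rw [← hF, hk x] at ha
    obtain ⟨h0, h1⟩ := sum_adj_bounds A h01 hdiag F hx
    rw [hf] at h1
    push_cast at ha h1
    omega
  refine ⟨hf, hS, fun x hx y hy => ?_⟩
  have hx' : σ x = x := (Finset.mem_filter.mp hx).2
  have hy' : σ y = y := (Finset.mem_filter.mp hy).2
  by_cases hxy : x = y
  · subst hxy
    rw [if_pos rfl, sum_adj_mul_self A h01 hsymm F x, hS x hx, hdiag x]; norm_num
  · rw [if_neg hxy]
    obtain ⟨b, hb⟩ := aut_fixed_pair_congr A hp σ hσ hA hx' hy'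
    rw [← hF, hsrg x y, if_neg hxy] at hb
    obtain ⟨h0, h1⟩ := sum_adj_mul_bounds A h01 hdiag F x hy
    rw [hS x hx] at h1
    have hAxy : A x y = 0 ∨ A x y = 1 := h01 x y
    push_cast at hb
    rcases hAxy with e | e <;> rw [e] at hb h1 ⊢ <;> omega

/-- **Refined fixed-point windows (gen 30).**  For a non-identity automorphism of odd prime order `p` with `f` fixed
points: `3: f ≡ 3 (6), 9 ≤ f ≤ 81` · `5: f ≡ 3 (10), 13 ≤ f ≤ 53` · `7: f ∈ {25, 39}` · `11: f = 25` · `13: f = 21` ·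
`p ≠ 17` · `p ≠ 23` · `37: f = 0` · `41: f = 5` · `83: f = 1`. -/
theorem aut_prime_windows_fs (hV : Fintype.card V = 333) (A : Matrix V V ℤ)
    (h01 : ∀ x y, A x y = 0 ∨ A x y = 1) (hsymm : ∀ x y, A y x = A x y) (hdiag : ∀ x, A x x = 0)
    (hk : ∀ x, ∑ y, A x y = 166) (hsrg : ∀ x y, ∑ z, A x z * A z y = 83 * (1 + (if x = y then 1 else 0)) - A x y)
    {p : ℕ} (hp : p.Prime) (hp2 : p ≠ 2) (σ : Equiv.Perm V) (hσ : σ ^ p = 1) (hσ1 : σ ≠ 1)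
    (hA : ∀ x y, A (σ x) (σ y) = A x y) :
    let f := (univ.filter fun x => σ x = x).card
    (p = 3 → f % 6 = 3 ∧ 9 ≤ f ∧ f ≤ 81) ∧ (p = 5 → f % 10 = 3 ∧ 13 ≤ f ∧ f ≤ 53) ∧ (p = 7 → f = 25 ∨ f = 39) ∧
    (p = 11 → f = 25) ∧ (p = 13 → f = 21) ∧ (p ≠ 17) ∧ (p ≠ 23) ∧
    (p = 37 → f = 0) ∧ (p = 41 → f = 5) ∧ (p = 83 → f = 1) := by
  intro f
  obtain ⟨w3, w5, -, -, w13, w17, -, w37, w41, w83⟩ :=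
    aut_prime_windows_refined hV A h01 hsymm hdiag hk hsrg hp hp2 σ hσ hσ1 hA
  obtain ⟨l3, l5⟩ := aut_order3_order5_fixed_lb hV A h01 hsymm hdiag hk hsrg hp σ hσ hσ1 hA
  refine ⟨fun h => ⟨(w3 h).1, l3 h, (w3 h).2⟩, fun h => ⟨(w5 h).1, l5 h, (w5 h).2⟩, ?_, ?_, w13, w17, ?_, w37, w41, w83⟩
  · rintro rfl; exact aut_order7_fixed hV A h01 hsymm hdiag hk hsrg σ hσ hσ1 hA
  · rintro rfl; exact aut_order11_fixed hV A h01 hsymm hdiag hk hsrg σ hσ hσ1 hA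
  · rintro rfl; exact no_aut_order_23 hV A h01 hsymm hdiag hk hsrg σ hσ hσ1 hA

/-- **Prime-order spectrum (gen 30): `p ∈ {2, 3, 5, 7, 11, 13, 37, 41, 83}`** (`23` removed from gen 29's list; `13`
is removed in `ConferenceGraph333Order13`). -/
theorem aut_prime_spectrum_fs (hV : Fintype.card V = 333) (A : Matrix V V ℤ)
    (h01 : ∀ x y, A x y = 0 ∨ A x y = 1) (hsymm : ∀ x y, A y x = A x y) (hdiag : ∀ x, A x x = 0)
    (hk : ∀ x, ∑ y, A x y = 166) (hsrg : ∀ x y, ∑ z, A x z * A z y = 83 * (1 + (if x = y then 1 else 0)) - A x y)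
    {p : ℕ} (hp : p.Prime) (σ : Equiv.Perm V) (hσ : σ ^ p = 1) (hσ1 : σ ≠ 1)
    (hA : ∀ x y, A (σ x) (σ y) = A x y) :
    p = 2 ∨ p = 3 ∨ p = 5 ∨ p = 7 ∨ p = 11 ∨ p = 13 ∨ p = 37 ∨ p = 41 ∨ p = 83 := by
  have h := aut_prime_spectrum_refined hV A h01 hsymm hdiag hk hsrg hp σ hσ hσ1 hA
  have h23 : p ≠ 23 := by
    rintro rfl; exact no_aut_order_23 hV A h01 hsymm hdiag hk hsrg σ hσ hσ1 hA
  omega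

end fixedSubgraph

end Summit.Ventures.DiscreteObjects.Hadamard
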